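import Summits.CriticalPhenomena.SAWScalingLimit.Theorems.SAWDevelopingMapObservableToSLEFloorPart
import Summits.CriticalPhenomena.SAWScalingLimit.Theorems.ObservableToSLE.Negative.TightnessNecessity
import HarnessLib

/-!
# Crux `SAWDevelopingMap.ObservableToSLE` (stmt-CriticalPhenomena-10472) — PLANNER-READY RESTATEMENT (C′ + E)

Continuation lead prover-line-stmt-CriticalPhenomena-10472-c2-0, 2026-08-16.  All three lines on this crux are dead at
the same typed stub (W2).  This file states, over tree vocabulary and checked on the farm, the restatement the three
leads and the standing disprover recommend, and proves that it closes the original crux and the route unchanged: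

* `HalfPlaneArchTightness` (HPAT) and `UniformModulus` (UIM): the two lattice estimates, verbatim the registered stubs
  `stub_halfPlaneArchTightness` / `stub_uniformModulus` — to be filed as statement items `[difficulty: open-problem]`
  (UIM is implied by DCS Conjecture 1, `Negative.ModulusNecessity`; HPAT is NOT known to be, Disproof §10.4);
* `FloorObservableToSLE` (C′): the crux NARROWED to the class its hypothesis binds — a THEOREM modulo HPAT + UIM today
  (`floorObservableToSLE_of_estimates` below = `FloorRatio.stub_floorObservableToSLE_of_estimates`, p114707);
* `BoundaryUniversality` (E): floor-class convergence ⟹ DCS Conjecture 1 as typed — the honest residue, its own crux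
  ("no mechanism in print"; implied by Conjecture 1, `boundaryUniversality_of_hexConjecture`);
* `observableToSLE_of_restatement : FloorObservableToSLE → BoundaryUniversality → ObservableToSLE` (two-line glue, landed as
  `FloorRatio.stub_observableToSLE_of_floor_of_boundaryUniversality`, p116305) and `closes_of_restatement`: the route's deciding
  theorem with `ObservableToSLE` replaced by the pair (C′, E) still concludes `SAWScalingLimit`.
-/

noncomputable section

open scoped BigOperators Topology NNReal ENNReal Classical
open Filter Set MeasureTheory Metric
open Literature.Probability.LatticeModels (HexVertex hexGraph hexCenter)
open Literature.Probability.RandomPlanarGeometry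
open Literature.Probability.RandomPlanarGeometry.SAW

namespace Summit.CriticalPhenomena.SAWScalingLimit.Cruxes.ObservableToSLE.Restatement

open Summit.CriticalPhenomena.SAWScalingLimit.Theses.SAWDevelopingMap

/-- **(HPAT) Half-plane arch tightness** — verbatim the registered stub `stub_halfPlaneArchTightness` of the crux: for `Λ`
above the floor through the boundary mid-edge `s` and `B` the upper half-box of radius `2Kn` about `s`, the `x_c`-mass of
self-avoiding walks `s → t` in `Λ` (floor mid-edges at distance `≤ n`) having a vertex at distance `≥ Kn` from `s` is at most
`ε` times the total `x_c`-mass of walks `s → t` in `B`, with `K = K(ε)` UNIFORM in the span `n`.  SLE(8/3) prediction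
`ε(K) = 1 − (1 − K⁻²)^{5/8}`; open (no RSW/FKG for the `n = 0` loop model); not implied by Conjecture 1 on bounded domains. -/
def HalfPlaneArchTightness : Prop :=
  ∀ ε : ℝ, 0 < ε → ∃ K : ℝ, 0 < K ∧ ∀ (n : ℕ), 1 ≤ n → ∀ (Λ B : Finset HexVertex)
    (s t : Sym2 HexVertex), s ∈ hexDomainBoundary Λ → t ∈ hexDomainBoundary Λ → s ≠ t →
    dist (hexMidpoint s) (hexMidpoint t) ≤ n → (hexMidpoint t).im = (hexMidpoint s).im →
    (∀ v ∈ Λ, (hexMidpoint s).im < (hexCenter v).im) →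
    (∀ v : HexVertex, v ∈ B ↔ ((hexMidpoint s).im < (hexCenter v).im ∧
      dist (hexCenter v) (hexMidpoint s) ≤ 2 * K * n)) →
    (∑ γ : HexMidEdgeSAW Λ s t, if ∃ v ∈ γ.verts, K * n ≤ dist (hexCenter v) (hexMidpoint s)
      then hexCriticalFugacity ^ γ.length else 0) ≤
    ε * ∑ γ : HexMidEdgeSAW B s t, hexCriticalFugacity ^ γ.length

/-- **(UIM) Uniform injectivity modulus** — verbatim the registered stub `stub_uniformModulus` of the crux: on every FLOOR
Dobrushin domain (Jordan, above the horizontal line through its two marked points, flat radius-`ρ` half-discs at both) with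
floor-vertex endpoints, for every `ε, η > 0` there is `θ > 0` such that for all small meshes the critical SAW curve class has
injectivity modulus `(ε, θ)` with `hexSAWLaw`-probability `≥ 1 − η`.  Open; implied by Conjecture 1
(`Negative.ModulusNecessity.floorUniformModulus_of_hexConjecture`). -/
def UniformModulus : Prop :=
  ∀ (D : DobrushinDomain) (ρ : ℝ) (a b : ℝ → HexVertex),
    (0 < ρ ∧ (D.pt 1).im = (D.pt 0).im ∧ D.carrier ⊆ {z : ℂ | (D.pt 0).im < z.im} ∧
    D.carrier ∩ ball (D.pt 0) ρ = {z : ℂ | (D.pt 0).im < z.im} ∩ ball (D.pt 0) ρ ∧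
    D.carrier ∩ ball (D.pt 1) ρ = {z : ℂ | (D.pt 1).im < z.im} ∩ ball (D.pt 1) ρ) →
    (IsEmbEndpointApprox hexGraph hexCenter D a b ∧ ∀ᶠ δ : ℝ in 𝓝[>] 0,
    (∃ u : HexVertex, hexGraph.Adj (a δ) u ∧ ((δ : ℂ) * hexCenter u).im ≤ (D.pt 0).im) ∧
    (∃ u : HexVertex, hexGraph.Adj (b δ) u ∧ ((δ : ℂ) * hexCenter u).im ≤ (D.pt 1).im)) →
    ∀ ε η : ℝ, 0 < ε → 0 < η → ∃ θ : ℝ, 0 < θ ∧ ∀ᶠ δ : ℝ in 𝓝[>] 0,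
      hexSAWLaw D.carrier δ (a δ) (b δ) {γ | γ.curve ∉ CurveClass.modulusClass ε θ} ≤
        ENNReal.ofReal η

/-- **(C′) The crux narrowed to the floor class**: `HexObservableLimit → HexTight →` for every FLOOR Dobrushin domain and
every floor-vertex endpoint approximation, the critical hexagonal SAW law `hexSAWLaw`, pushed to `CurveClass ℂ`, converges
in law to chordal SLE(8/3).  A theorem modulo HPAT + UIM (`floorObservableToSLE_of_estimates`). -/
def FloorObservableToSLE : Prop :=
  HexObservableLimit → HexTight →
    ∀ (D : DobrushinDomain) (ρ : ℝ) (a b : ℝ → HexVertex),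
    (0 < ρ ∧ (D.pt 1).im = (D.pt 0).im ∧ D.carrier ⊆ {z : ℂ | (D.pt 0).im < z.im} ∧
    D.carrier ∩ ball (D.pt 0) ρ = {z : ℂ | (D.pt 0).im < z.im} ∩ ball (D.pt 0) ρ ∧
    D.carrier ∩ ball (D.pt 1) ρ = {z : ℂ | (D.pt 1).im < z.im} ∩ ball (D.pt 1) ρ) →
    (IsEmbEndpointApprox hexGraph hexCenter D a b ∧ ∀ᶠ δ : ℝ in 𝓝[>] 0,
    (∃ u : HexVertex, hexGraph.Adj (a δ) u ∧ ((δ : ℂ) * hexCenter u).im ≤ (D.pt 0).im) ∧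
    (∃ u : HexVertex, hexGraph.Adj (b δ) u ∧ ((δ : ℂ) * hexCenter u).im ≤ (D.pt 1).im)) →
    ConvergesInLawToSLE ((8 : ℝ≥0) / 3) D
      (fun δ (γ : HexDomainSAW D.carrier δ (a δ) (b δ)) => γ.curve)
      (fun δ => hexSAWLaw D.carrier δ (a δ) (b δ))

/-- **(E) Boundary universality** — the residue W2 as its own crux: SLE(8/3) convergence on the floor class ⟹ DCS
Conjecture 1 as typed (`HexConjecture`, stmt-CriticalPhenomena-0808: every Dobrushin domain, every `IsEmbEndpointApprox`).
Content: marked points whose local boundary class is not a horizontal floor with the domain above; interior / general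
endpoint sequences; flat-at-both-points domains not above the line through the marks.  No mechanism in print (no RSW /
separation for SAW; Kennedy–Lawler lattice effects persist in boundary ensembles); implied by Conjecture 1. -/
def BoundaryUniversality : Prop :=
  (∀ (D : DobrushinDomain) (ρ : ℝ) (a b : ℝ → HexVertex),
    (0 < ρ ∧ (D.pt 1).im = (D.pt 0).im ∧ D.carrier ⊆ {z : ℂ | (D.pt 0).im < z.im} ∧
    D.carrier ∩ ball (D.pt 0) ρ = {z : ℂ | (D.pt 0).im < z.im} ∩ ball (D.pt 0) ρ ∧
    D.carrier ∩ ball (D.pt 1) ρ = {z : ℂ | (D.pt 1).im < z.im} ∩ ball (D.pt 1) ρ) →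
    (IsEmbEndpointApprox hexGraph hexCenter D a b ∧ ∀ᶠ δ : ℝ in 𝓝[>] 0,
    (∃ u : HexVertex, hexGraph.Adj (a δ) u ∧ ((δ : ℂ) * hexCenter u).im ≤ (D.pt 0).im) ∧
    (∃ u : HexVertex, hexGraph.Adj (b δ) u ∧ ((δ : ℂ) * hexCenter u).im ≤ (D.pt 1).im)) →
    ConvergesInLawToSLE ((8 : ℝ≥0) / 3) D
      (fun δ (γ : HexDomainSAW D.carrier δ (a δ) (b δ)) => γ.curve)
      (fun δ => hexSAWLaw D.carrier δ (a δ) (b δ))) →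
  HexConjecture

/-- (C′) is a theorem modulo the two estimates — the landed floor part of line floor-ratio (p114707). -/
theorem floorObservableToSLE_of_estimates :
    HalfPlaneArchTightness → UniformModulus → FloorObservableToSLE :=
  Summit.CriticalPhenomena.SAWScalingLimit.Theorems.ObservableToSLE.FloorRatio.stub_floorObservableToSLE_of_estimates

/-- The restated pair closes the ORIGINAL crux by name (landed glue, p116305). -/
theorem observableToSLE_of_restatement :
    FloorObservableToSLE → BoundaryUniversality → ObservableToSLE :=
  fun hC hE hO hT => hE (hC hO hT)

/-- (E) is implied by Conjecture 1 (landed, p116305): not refutable short of refuting Conjecture 1. -/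
theorem boundaryUniversality_of_hexConjecture : HexConjecture → BoundaryUniversality :=
  fun h _ => h

/-- Modulo HPAT, UIM and the two route hypotheses, (E) IS Conjecture 1 (landed, p116305): the exact content left. -/
theorem boundaryUniversality_iff_hexConjecture_of_estimates :
    HalfPlaneArchTightness → UniformModulus → HexObservableLimit → HexTight →
      (BoundaryUniversality ↔ HexConjecture) :=
  fun hH hU hO hT => ⟨fun hE => hE (floorObservableToSLE_of_estimates hH hU hO hT), fun h _ => h⟩

/-- **The route closes unchanged after the restatement**: the deciding theorem of `Theses/SAWDevelopingMap.lean` (rev 14,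
`closes : NoFoldBound → InteriorFlattening → QCIdentification → HexTight → ObservableToSLE → HexTransfer → SAWScalingLimit`)
with the crux `ObservableToSLE` replaced by the pair (C′, E). -/
theorem closes_of_restatement :
    NoFoldBound → InteriorFlattening → QCIdentification → HexTight →
      FloorObservableToSLE → BoundaryUniversality → HexTransfer → _root_.SAWScalingLimit :=
  fun hK hM hId hT hC hE hX => closes hK hM hId hT (observableToSLE_of_restatement hC hE) hX

/-- Variant with the two estimates as items instead of (C′): `closes` from HPAT, UIM, (E) and the other cruxes. -/
theorem closes_of_estimates :
    NoFoldBound → InteriorFlattening → QCIdentification → HexTight →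
      HalfPlaneArchTightness → UniformModulus → BoundaryUniversality → HexTransfer → _root_.SAWScalingLimit :=
  fun hK hM hId hT hH hU hE hX =>
    closes_of_restatement hK hM hId hT (floorObservableToSLE_of_estimates hH hU) hE hX

end Summit.CriticalPhenomena.SAWScalingLimit.Cruxes.ObservableToSLE.Restatement

end
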